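import Literature.Algebra.Homology.OrderedCechSystem
import HarnessLib

/-!
# The ordered Čech complex of a system of modules, II: functoriality, `Ȟ⁰`, the submodule model
# (Görtz–Wedhorn II, Lemma 21.65, Def. 21.68; The Stacks Project, Tags 01FG, 01EJ)

Sequel to `Algebra/Homology/OrderedCechSystem` (`OrderedCech.sysComplex M`, `M : Finset ι ⥤ ModuleCat A`):
* functoriality in the system: `sysCochainMap`, **`sysComplexMap`** (identities, composition, isomorphisms
  `sysComplexMapIso`) and **`shortExact_sysSC`**: a member-by-member short exact sequence of systems gives a
  short exact sequence of complexes (Stacks 01EJ); `sysComplexMapNE` / `sysComplexIsoNE` for morphisms /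
  isomorphisms given on NON-EMPTY members only (the empty member never enters the complex);
* `Ȟ⁰`: `sysD_zero_eq_zero_iff` — a `0`-cochain is a cocycle iff its vertex values have equal restrictions
  to all edges (Görtz–Wedhorn II, Lemma 21.65);
* the submodule model of `Algebra/Homology/OrderedCech`: `subfamilyFunctor F hF` and
  **`sysComplexIsoComplex : sysComplex (subfamilyFunctor F hF) ≅ OrderedCech.complex F hF`** (the identity
  componentwise).
Elementary and proved (Mathlib: `Hom.isoOfComponents`, `shortExact_of_degreewise_shortExact`).

## References

* U. Görtz, T. Wedhorn, *Algebraic Geometry II: Cohomology of Schemes*, Springer Spektrum (2023),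
  doi:10.1007/978-3-658-43031-3: Lemma 21.65, Def. 21.68, Cor. 21.70 (pp. 179–181). [GortzWedhorn2023]
* The Stacks Project, Tags 01FG, 01EJ. [StacksProject]
-/

universe v u

open CategoryTheory TensorProduct

set_option backward.isDefEq.respectTransparency false

noncomputable section

namespace Literature.Algebra.Homology

namespace OrderedCech

variable {ι : Type} [LinearOrder ι] {A : Type u} [CommRing A]

/-! ### Functoriality in the system -/

section Map

variable {M M' M'' : Finset ι ⥤ ModuleCat.{v} A} (φ : M ⟶ M') (ψ : M' ⟶ M'')

/-- The map of cochains induced by a morphism of systems (componentwise). [folklore] [cite: GortzWedhorn2023, Def. 21.68 (p. 180)] -/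
def sysCochainMap (n : ℤ) : SysCochain M n →ₗ[A] SysCochain M' n :=
  LinearMap.pi fun σ => (φ.app σ.1).hom ∘ₗ LinearMap.proj σ

/-- Components of the induced map. [folklore] [cite: GortzWedhorn2023, Def. 21.68 (p. 180)] -/
@[simp] theorem sysCochainMap_apply (n : ℤ) (g : SysCochain M n) (σ : Simplex ι n) :
    sysCochainMap φ n g σ = (φ.app σ.1).hom (g σ) := rfl

/-- The induced map commutes with `ext0At` (naturality of `φ`). [folklore] [cite: GortzWedhorn2023, Def. 21.68 (p. 180)] -/
theorem ext0At_sysCochainMap {n : ℤ} (g : SysCochain M n) (s t : Finset ι) :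
    (sysCochainMap φ n g).ext0At s t = (φ.app t).hom (g.ext0At s t) := by
  unfold SysCochain.ext0At
  split_ifs with h
  · rw [sysCochainMap_apply, ← ModuleCat.comp_apply, ← φ.naturality, ModuleCat.comp_apply]
  · rw [map_zero]

/-- **The induced map of cochains commutes with the Čech differentials.** [folklore] [cite: GortzWedhorn2023, Def. 21.68 (p. 180)] -/
theorem sysD_sysCochainMap {n : ℤ} (g : SysCochain M n) :
    sysD M' n (sysCochainMap φ n g) = sysCochainMap φ (n + 1) (sysD M n g) := by
  funext σ
  rw [sysD_apply, sysCochainMap_apply, sysD_apply, map_sum]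
  refine Finset.sum_congr rfl fun a _ => ?_
  rw [map_smul, ext0At_sysCochainMap]

/-- **The chain map of ordered Čech complexes induced by a morphism of systems.** [folklore] [cite: GortzWedhorn2023, Def. 21.68 (p. 180)] -/
def sysComplexMap : sysComplex M ⟶ sysComplex M' :=
  CochainComplex.ofHom (fun n => ModuleCat.ofHom (sysCochainMap φ n)) fun n => by
    rw [sysComplex_d, sysComplex_d]
    ext g
    exact sysD_sysCochainMap φ g

/-- Components of the chain map. [folklore] [cite: GortzWedhorn2023, Def. 21.68 (p. 180)] -/
@[simp] theorem sysComplexMap_f (n : ℤ) : (sysComplexMap φ).f n = ModuleCat.ofHom (sysCochainMap φ n) := rfl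

/-- The chain map of the identity is the identity. [folklore] [cite: GortzWedhorn2023, Def. 21.68 (p. 180)] -/
theorem sysComplexMap_id : sysComplexMap (𝟙 M) = 𝟙 (sysComplex M) := by
  ext n g
  rfl

/-- The chain map of a composite is the composite. [folklore] [cite: GortzWedhorn2023, Def. 21.68 (p. 180)] -/
theorem sysComplexMap_comp : sysComplexMap (φ ≫ ψ) = sysComplexMap φ ≫ sysComplexMap ψ := by
  ext n g
  rfl

/-- **An isomorphism of systems induces an isomorphism of ordered Čech complexes.** [folklore] [cite: GortzWedhorn2023, Def. 21.68 (p. 180)] -/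
def sysComplexMapIso (e : M ≅ M') : sysComplex M ≅ sysComplex M' where
  hom := sysComplexMap e.hom
  inv := sysComplexMap e.inv
  hom_inv_id := by rw [← sysComplexMap_comp, e.hom_inv_id, sysComplexMap_id]
  inv_hom_id := by rw [← sysComplexMap_comp, e.inv_hom_id, sysComplexMap_id]

/-- Componentwise injective morphisms of systems give injective maps of cochains. [folklore] [cite: GortzWedhorn2023, Def. 21.68 (p. 180)] -/
theorem sysCochainMap_injective {n : ℤ} (hinj : ∀ s : Finset ι, s.Nonempty → Function.Injective (φ.app s).hom) :
    Function.Injective (sysCochainMap φ n) := by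
  intro g g' h
  funext σ
  exact hinj σ.1 σ.2.1 (congr_fun h σ)

/-- Componentwise surjective morphisms of systems give surjective maps of cochains. [folklore] [cite: GortzWedhorn2023, Def. 21.68 (p. 180)] -/
theorem sysCochainMap_surjective {n : ℤ}
    (hsurj : ∀ s : Finset ι, s.Nonempty → Function.Surjective (φ.app s).hom) :
    Function.Surjective (sysCochainMap φ n) := by
  intro g'
  choose f hf using fun σ : Simplex ι n => hsurj σ.1 σ.2.1 (g' σ)
  exact ⟨f, funext hf⟩

/-- Componentwise exact pairs of morphisms of systems give exact pairs of maps of cochains. [folklore] [cite: GortzWedhorn2023, Def. 21.68 (p. 180)] -/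
theorem sysCochainMap_exact {n : ℤ}
    (hex : ∀ s : Finset ι, s.Nonempty → Function.Exact (φ.app s).hom (ψ.app s).hom) :
    Function.Exact (sysCochainMap φ n) (sysCochainMap ψ n) := by
  intro g'
  constructor
  · intro h
    have hσ : ∀ σ : Simplex ι n, ∃ x, (φ.app σ.1).hom x = g' σ := fun σ =>
      ((hex σ.1 σ.2.1) (g' σ)).1 (congr_fun h σ)
    choose f hf using hσ
    exact ⟨f, funext hf⟩
  · rintro ⟨g, rfl⟩
    funext σ
    exact ((hex σ.1 σ.2.1) _).2 ⟨g σ, rfl⟩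

/-- The short complex of ordered Čech complexes attached to a composable pair of morphisms of systems
with zero composite. [folklore] [cite: GortzWedhorn2023, Def. 21.68 (p. 180)] -/
def sysSC (h : φ ≫ ψ = 0) : ShortComplex (CochainComplex (ModuleCat.{v} A) ℤ) :=
  ShortComplex.mk (sysComplexMap φ) (sysComplexMap ψ) (by rw [← sysComplexMap_comp, h]; ext n g; rfl)

/-- **A sequence of systems which is short exact member by member (for non-empty members) gives a short
exact sequence of ordered Čech complexes** (exactness of complexes of modules is checked degreewise;
Stacks Project, Tag 01EJ). [cite: StacksProject, Tag 01EJ] -/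
theorem shortExact_sysSC (h : φ ≫ ψ = 0)
    (hinj : ∀ s : Finset ι, s.Nonempty → Function.Injective (φ.app s).hom)
    (hsurj : ∀ s : Finset ι, s.Nonempty → Function.Surjective (ψ.app s).hom)
    (hex : ∀ s : Finset ι, s.Nonempty → Function.Exact (φ.app s).hom (ψ.app s).hom) :
    (sysSC φ ψ h).ShortExact := by
  refine HomologicalComplex.shortExact_of_degreewise_shortExact _ fun n => ?_
  exact ModuleCat.shortComplex_shortExact _ (sysCochainMap_exact φ ψ hex)
    (sysCochainMap_injective φ hinj) (sysCochainMap_surjective ψ hsurj)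

end Map


/-! ### Morphisms of systems given on non-empty members only -/

section MapNE

variable {M M' : Finset ι ⥤ ModuleCat.{v} A}
variable (φ : ∀ s : Finset ι, s.Nonempty → (M.obj s →ₗ[A] M'.obj s))
variable (hφ : ∀ (s t : Finset ι) (hs : s.Nonempty) (ht : t.Nonempty) (h : s ⊆ t) (x : M.obj s),
  φ t ht ((M.map (homOfLE h)).hom x) = (M'.map (homOfLE h)).hom (φ s hs x))

/-- The map of cochains induced by linear maps `φ_s : M s → M' s` given on NON-EMPTY `s` only (the value
of a system at `∅` never enters the ordered Čech complex). [folklore] [cite: GortzWedhorn2023, Def. 21.68 (p. 180)] -/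
def sysCochainMapNE (n : ℤ) : SysCochain M n →ₗ[A] SysCochain M' n :=
  LinearMap.pi fun σ => φ σ.1 σ.2.1 ∘ₗ LinearMap.proj σ

/-- Components of the induced map. [folklore] [cite: GortzWedhorn2023, Def. 21.68 (p. 180)] -/
@[simp] theorem sysCochainMapNE_apply (n : ℤ) (g : SysCochain M n) (σ : Simplex ι n) :
    sysCochainMapNE φ n g σ = φ σ.1 σ.2.1 (g σ) := rfl

include hφ in
/-- The induced map commutes with `ext0At` towards non-empty `t`. [folklore] [cite: GortzWedhorn2023, Def. 21.68 (p. 180)] -/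
theorem ext0At_sysCochainMapNE {n : ℤ} (g : SysCochain M n) (s t : Finset ι) (ht : t.Nonempty) :
    (sysCochainMapNE φ n g).ext0At s t = φ t ht (g.ext0At s t) := by
  unfold SysCochain.ext0At
  split_ifs with h
  · rw [sysCochainMapNE_apply, hφ _ _ h.1.1 ht h.2]
  · rw [map_zero]

include hφ in
/-- **The induced map of cochains commutes with the Čech differentials.** [folklore] [cite: GortzWedhorn2023, Def. 21.68 (p. 180)] -/
theorem sysD_sysCochainMapNE {n : ℤ} (g : SysCochain M n) :
    sysD M' n (sysCochainMapNE φ n g) = sysCochainMapNE φ (n + 1) (sysD M n g) := by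
  funext σ
  rw [sysD_apply, sysCochainMapNE_apply, sysD_apply, map_sum]
  refine Finset.sum_congr rfl fun a _ => ?_
  rw [map_smul, ext0At_sysCochainMapNE φ hφ g _ _ σ.2.1]

/-- **The chain map induced by maps of systems given on non-empty members.** [folklore] [cite: GortzWedhorn2023, Def. 21.68 (p. 180)] -/
def sysComplexMapNE : sysComplex M ⟶ sysComplex M' :=
  CochainComplex.ofHom (fun n => ModuleCat.ofHom (sysCochainMapNE φ n)) fun n => by
    rw [sysComplex_d, sysComplex_d]
    ext g
    exact sysD_sysCochainMapNE φ hφ g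

/-- Components of the chain map. [folklore] [cite: GortzWedhorn2023, Def. 21.68 (p. 180)] -/
@[simp] theorem sysComplexMapNE_f (n : ℤ) :
    (sysComplexMapNE φ hφ).f n = ModuleCat.ofHom (sysCochainMapNE φ n) := rfl

end MapNE

section IsoNE

variable {M M' : Finset ι ⥤ ModuleCat.{v} A}
variable (e : ∀ s : Finset ι, s.Nonempty → (M.obj s ≃ₗ[A] M'.obj s))
variable (he : ∀ (s t : Finset ι) (hs : s.Nonempty) (ht : t.Nonempty) (h : s ⊆ t) (x : M.obj s),
  e t ht ((M.map (homOfLE h)).hom x) = (M'.map (homOfLE h)).hom (e s hs x))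

include he in
omit [LinearOrder ι] in
/-- Naturality of the inverses. [folklore] [cite: GortzWedhorn2023, Def. 21.68 (p. 180)] -/
theorem naturality_symm_of_naturality (s t : Finset ι) (hs : s.Nonempty) (ht : t.Nonempty) (h : s ⊆ t)
    (y : M'.obj s) :
    (e t ht).symm ((M'.map (homOfLE h)).hom y) = (M.map (homOfLE h)).hom ((e s hs).symm y) := by
  apply (e t ht).injective
  rw [LinearEquiv.apply_symm_apply, he s t hs ht h, LinearEquiv.apply_symm_apply]

/-- **An isomorphism of ordered Čech complexes from linear isomorphisms `M s ≅ M' s` on the NON-EMPTY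
members, natural with respect to inclusions of non-empty members** (the values at `∅` are irrelevant —
e.g. `Γ(W_∅, 𝓛) = Γ(X, 𝓛)` need not match). [folklore] [cite: GortzWedhorn2023, Def. 21.68 (p. 180)] -/
def sysComplexIsoNE : sysComplex M ≅ sysComplex M' where
  hom := sysComplexMapNE (fun s hs => (e s hs).toLinearMap) (fun s t hs ht h x => he s t hs ht h x)
  inv := sysComplexMapNE (fun s hs => (e s hs).symm.toLinearMap)
    (fun s t hs ht h y => naturality_symm_of_naturality e he s t hs ht h y)
  hom_inv_id := by
    ext n g
    change sysCochainMapNE (fun s hs => (e s hs).symm.toLinearMap) n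
      (sysCochainMapNE (fun s hs => (e s hs).toLinearMap) n g) = g
    funext σ
    simp
  inv_hom_id := by
    ext n g
    change sysCochainMapNE (fun s hs => (e s hs).toLinearMap) n
      (sysCochainMapNE (fun s hs => (e s hs).symm.toLinearMap) n g) = g
    funext σ
    simp

/-- Components of `sysComplexIsoNE`. [folklore] [cite: GortzWedhorn2023, Def. 21.68 (p. 180)] -/
theorem sysComplexIsoNE_hom_f_apply (n : ℤ) (g : SysCochain M n) (σ : Simplex ι n) :
    ((sysComplexIsoNE e he).hom.f n).hom g σ = e σ.1 σ.2.1 (g σ) := rfl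

end IsoNE

/-! ### `Ȟ⁰` of a system: compatible families -/

section HZero

variable (M : Finset ι ⥤ ModuleCat.{v} A)

/-- `{a} ⊆ {a, b}`. [folklore] [cite: GortzWedhorn2023, Def. 21.68 (p. 180)] -/
theorem singleton_subset_pair_left (a b : ι) : ({a} : Finset ι) ⊆ {a, b} :=
  Finset.singleton_subset_iff.2 (Finset.mem_insert_self a _)

/-- `{b} ⊆ {a, b}`. [folklore] [cite: GortzWedhorn2023, Def. 21.68 (p. 180)] -/
theorem singleton_subset_pair_right (a b : ι) : ({b} : Finset ι) ⊆ {a, b} :=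
  Finset.singleton_subset_iff.2 (Finset.mem_insert_of_mem (Finset.mem_singleton_self b))

/-- On an edge `a < b`: `(d g)_{ab} = res g_b - res g_a`. [folklore] [cite: GortzWedhorn2023, Def. 21.68 (p. 180)] -/
theorem sysD_edge (g : SysCochain M 0) (a b : ι) (hab : a < b) :
    sysD M 0 g (edge a b hab) =
      (M.map (homOfLE (singleton_subset_pair_right a b))).hom (g (vertex b)) -
        (M.map (homOfLE (singleton_subset_pair_left a b))).hom (g (vertex a)) := by
  rw [sysD_apply]
  change ∑ x ∈ ({a, b} : Finset ι), sign A {a, b} x • g.ext0At (({a, b} : Finset ι).erase x) {a, b} = _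
  rw [Finset.sum_pair hab.ne]
  have h1 : ({a, b} : Finset ι).erase a = {b} := by
    rw [Finset.erase_insert]
    simp [hab.ne]
  have h2 : ({a, b} : Finset ι).erase b = {a} := by
    rw [Finset.pair_comm, Finset.erase_insert]
    simp [hab.ne']
  have s1 : sign A ({a, b} : Finset ι) a = 1 := by
    unfold sign
    rw [show ({a, b} : Finset ι).filter (· < a) = ∅ from ?_, Finset.card_empty, pow_zero]
    ext x
    simp only [Finset.mem_filter, Finset.mem_insert, Finset.mem_singleton, Finset.notMem_empty,
      iff_false, not_and]
    rintro (rfl | rfl)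
    · exact lt_irrefl _
    · exact lt_asymm hab
  have s2 : sign A ({a, b} : Finset ι) b = -1 := by
    unfold sign
    rw [show ({a, b} : Finset ι).filter (· < b) = {a} from ?_, Finset.card_singleton, pow_one]
    ext x
    simp only [Finset.mem_filter, Finset.mem_insert, Finset.mem_singleton]
    constructor
    · rintro ⟨rfl | rfl, hx⟩
      · rfl
      · exact absurd hx (lt_irrefl _)
    · rintro rfl
      exact ⟨Or.inl rfl, hab⟩
  rw [h1, h2, s1, s2, one_smul, neg_one_smul, ← sub_eq_add_neg]
  have eb : g.ext0At {b} {a, b} = (M.map (homOfLE (singleton_subset_pair_right a b))).hom (g (vertex b)) :=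
    SysCochain.ext0At_val g (vertex b) _ (singleton_subset_pair_right a b)
  have ea : g.ext0At {a} {a, b} = (M.map (homOfLE (singleton_subset_pair_left a b))).hom (g (vertex a)) :=
    SysCochain.ext0At_val g (vertex a) _ (singleton_subset_pair_left a b)
  rw [eb, ea]

/-- **A `0`-cochain of a system is a cocycle iff its vertex values restrict compatibly to every edge**
(Görtz–Wedhorn II, Lemma 21.65: `Ȟ⁰` is the equaliser of `Π_i Γ(U_i) ⇉ Π_{i<j} Γ(U_{ij})`).
[cite: GortzWedhorn2023, Lemma 21.65 (p. 179)] -/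
theorem sysD_zero_eq_zero_iff (g : SysCochain M 0) :
    sysD M 0 g = 0 ↔ ∀ (a b : ι) (hab : a < b),
      (M.map (homOfLE (singleton_subset_pair_left a b))).hom (g (vertex a)) =
        (M.map (homOfLE (singleton_subset_pair_right a b))).hom (g (vertex b)) := by
  constructor
  · intro h a b hab
    have := sysD_edge M g a b hab
    rw [h] at this
    exact (sub_eq_zero.1 this.symm).symm
  · intro h
    funext σ
    obtain ⟨a, b, hab, rfl⟩ := exists_eq_edge σ
    rw [sysD_edge, h a b hab, sub_self]
    rfl

end HZero

/-! ### Comparison with the submodule model -/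

section Subfamily

variable {𝕂 : Type v} [AddCommGroup 𝕂] [Module A 𝕂] (F : Finset ι → Submodule A 𝕂) (hF : Monotone F)

/-- A monotone family of submodules as a system of modules (restriction = inclusion). [folklore] [cite: GortzWedhorn2023, Def. 21.68 (p. 180)] -/
def subfamilyFunctor : Finset ι ⥤ ModuleCat.{v} A where
  obj s := ModuleCat.of A (F s)
  map {s t} h := ModuleCat.ofHom (Submodule.inclusion (hF h.le))
  map_id s := by ext x; rfl
  map_comp f g := by ext x; rfl

omit [LinearOrder ι] in
/-- The objects of the subfamily system. [folklore] [cite: GortzWedhorn2023, Def. 21.68 (p. 180)] -/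
@[simp] theorem subfamilyFunctor_obj (s : Finset ι) : (subfamilyFunctor F hF).obj s = ModuleCat.of A (F s) := rfl

omit [LinearOrder ι] in
/-- The maps of the subfamily system are the inclusions. [folklore] [cite: GortzWedhorn2023, Def. 21.68 (p. 180)] -/
theorem subfamilyFunctor_map_apply {s t : Finset ι} (h : s ⟶ t) (x : F s) :
    Subtype.val (p := (· ∈ F t)) (((subfamilyFunctor F hF).map h).hom x) = x := rfl

/-- `ext0At` of the subfamily system, read in `𝕂`, is `ext0` when `s ⊆ t`. [folklore] [cite: GortzWedhorn2023, Def. 21.68 (p. 180)] -/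
theorem coe_ext0At_subfamily {n : ℤ} (g : SysCochain (subfamilyFunctor F hF) n) (s t : Finset ι)
    (hst : s ⊆ t) : Subtype.val (p := (· ∈ F t)) (g.ext0At s t) = Cochain.ext0 (F := F) g s := by
  unfold SysCochain.ext0At Cochain.ext0
  by_cases hs : s.Nonempty ∧ (s.card : ℤ) = n + 1
  · rw [dif_pos ⟨hs, hst⟩, dif_pos hs]
    rfl
  · rw [dif_neg (fun h => hs h.1), dif_neg hs]
    rfl

/-- The two differentials agree on the subfamily system. [folklore] [cite: GortzWedhorn2023, Def. 21.68 (p. 180)] -/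
theorem sysD_subfamily_eq (n : ℤ) (g : SysCochain (subfamilyFunctor F hF) n) :
    sysD (subfamilyFunctor F hF) n g = d F hF n g := by
  funext σ
  rw [sysD_apply]
  change _ = (∑ a ∈ σ.1, faceMap F hF n σ a) g
  rw [LinearMap.sum_apply]
  refine Finset.sum_congr rfl fun a _ => ?_
  unfold SysCochain.ext0At faceMap
  by_cases h : (σ.1.erase a).Nonempty ∧ ((σ.1.erase a).card : ℤ) = n + 1
  · rw [dif_pos ⟨h, Finset.erase_subset a σ.1⟩, dif_pos h]
    rfl
  · rw [dif_neg (fun h' => h h'.1), dif_neg h, smul_zero, LinearMap.zero_apply]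

/-- The identification of cochains of the subfamily system with cochains of the family (the identity
on underlying functions). [folklore] [cite: GortzWedhorn2023, Def. 21.68 (p. 180)] -/
def sysCochainToCochain (n : ℤ) : SysCochain (subfamilyFunctor F hF) n →ₗ[A] Cochain F n where
  toFun g := fun σ => g σ
  map_add' _ _ := rfl
  map_smul' _ _ := rfl

/-- The inverse identification. [folklore] [cite: GortzWedhorn2023, Def. 21.68 (p. 180)] -/
def cochainToSysCochain (n : ℤ) : Cochain F n →ₗ[A] SysCochain (subfamilyFunctor F hF) n where
  toFun g := fun σ => g σ
  map_add' _ _ := rfl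
  map_smul' _ _ := rfl

/-- **The ordered Čech complex of the subfamily system IS the ordered Čech complex of the family**
(componentwise the identity). [cite: GortzWedhorn2023, Def. 21.68 (p. 180)] -/
def sysComplexIsoComplex : sysComplex (subfamilyFunctor F hF) ≅ complex F hF :=
  HomologicalComplex.Hom.isoOfComponents
    (fun n => LinearEquiv.toModuleIso
      { sysCochainToCochain F hF n with
        invFun := cochainToSysCochain F hF n
        left_inv := fun _ => rfl
        right_inv := fun _ => rfl })
    fun n m hnm => by
      change n + 1 = m at hnm
      subst hnm
      rw [sysComplex_d, complex_d]
      ext g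
      exact sysD_subfamily_eq F hF n g

/-- The comparison isomorphism is the identity on underlying functions. [folklore] [cite: GortzWedhorn2023, Def. 21.68 (p. 180)] -/
theorem sysComplexIsoComplex_hom_f_apply (n : ℤ) (g : SysCochain (subfamilyFunctor F hF) n)
    (σ : Simplex ι n) : ((sysComplexIsoComplex F hF).hom.f n).hom g σ = g σ := rfl

end Subfamily

end OrderedCech

end Literature.Algebra.Homology

end
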